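import Summits.Parity.GeneralizedHardyLittlewood.Theorems.PrimeLevelFamEdgeMomentsBeyondDiagonalDiagDecorShiftedBlockDecor
import HarnessLib

/-!
# Route `PrimeLevelFamEdge`, crux K_A `MomentsBeyondDiagonal` (stmt-Parity-20007), line «petersson_layers» v4, stub `stub_diag`:
# **the decorated shifted block at the level of the Selberg form, and the instance `D = P₂`:
# `Sel(τP₂(k₁)ℓ⁺(k₁)^{r₁}·τ(k₂)ℓ⁺(k₂)^{r₂}·B^p) = (π²/6)²(∫₀¹(λ−u)^p(−2u^{r₁}P)(u^{r₂}P)″)·log^{p+r₁+r₂}M·log M/log²M + O(log^{p+r₁+r₂}M/log²M)`**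

Census R3(ii), ANALYTIC HALF; continuation of `…DiagDecorShiftedBlockDecor` (abstract decoration `D(k₁)` with a
master-input family `(R_r, s)`; `B = λlog M − log g − log(M/(cg))`, `ℓ⁺(k) = log((M/(cg))/k)`):

* `selbergBlockDecor_expand` — EXACT expansion of `Sel(τDℓ⁺^{r₁}·τℓ⁺^{r₂}·B^p)` along `−log g`
  (`selbergInner_eq_W_sq_mul` + binomial theorem), as in `…DiagDecorShiftedBlock.selbergBlock_expand`;
* `abs_selbergBlockDecor_sub_le` — **the decorated block asymptotic** from the master family of `D` (two-scale format for
  `T^{[r₁]}/log^{r₁}M` with `(R_{r₁}, s)`) — `t = 0` piece = `abs_harmonicShiftedDecor_sub_le`, `t ≥ 1` pieces =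
  `abs_collapseShiftedDecor_logPow_le` with the crude size from `abs_profileCoord_crude_le`;
* `abs_shiftedCoordPrimeSq_sub_le` — the instance `D = P₂ = Σ_{p∣k}log²p`: `R_r = −2·X^rP`, `s = 0`
  (`…DiagDecorMasterInputsLog.masterInput_tau_primeSq` at the shifted profile `X^rP` + `sum_coeff_X_pow_mul`);
* `abs_selbergBlockPrimeSq_sub_le` — **the `P₂`-block asymptotic displayed in the title** — with `…DiagDecorShiftedBlock`
  this evaluates BOTH monomial families of the order-`(1,1)` polynomial part (`…DiagDecorWeightOneOne`).

Def-free; theorems only. Helper `--supports stmt-Parity-20007`; closes nothing; K_A, K_B and the Parity summit are NOT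
proved; nothing about Landau–Siegel zeros.

## References
* E. Kowalski, P. Michel, J. VanderKam, J. reine angew. Math. 526 (2000), (23)–(28) pp. 13–15 and Prop. 5.1 p. 18.
  [cite: KowalskiMichelVanderKam2000, (23)–(28) — derivation (diagonal main term in real Selberg coordinates)]
-/

noncomputable section

open scoped Real ArithmeticFunction.Moebius
open Finset ArithmeticFunction Polynomial MeasureTheory intervalIntegral

namespace Summit.Parity.GeneralizedHardyLittlewood.Theorems.MomentsBeyondDiagonal.DiagKernel

open Literature.NumberTheory.LFunctions Literature.NumberTheory.LFunctions.KMV2000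
open MollifierMainTerm (W)
open SelbergCoord (kappa)
open Literature.NumberTheory.Sieve (one_le_log_of_three_le)
open Summit.Parity.GeneralizedHardyLittlewood.Theorems.BeyondDiagonalBeatsQuarter.KernelFormXSq
  (mainConst divWeight divWeight_nonneg mainConst_nonneg)

variable (Dk : ℕ → ℝ) (R : ℕ → ℝ[X]) (s : ℕ)

/-- Binomial bookkeeping: `μ(g)c·(a − log g)^p·(x(y₁y₂)) = Σ_t C(p,t)(−1)^t·(μ(g)c(log g)^t·(x(a^{p−t}y₁y₂)))`. [folklore] -/
private theorem moebius_mul_sub_log_pow_eq' (g : ℕ) (cc a x y₁ y₂ : ℝ) (p : ℕ) :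
    (μ g : ℝ) * cc * ((a - Real.log g) ^ p * (x * (y₁ * y₂))) =
      ∑ t ∈ Finset.range (p + 1), (p.choose t : ℝ) * (-1) ^ t *
        ((μ g : ℝ) * cc * Real.log g ^ t * (x * (a ^ (p - t) * y₁ * y₂))) := by
  rw [show a - Real.log g = -Real.log g + a by ring, add_pow, Finset.sum_mul, Finset.mul_sum]
  refine Finset.sum_congr rfl fun t _ ↦ ?_
  rw [neg_pow]
  ring

/-- Assembly bookkeeping: `|Σ_{t≤p}F(t) − main| ≤ (C₀ + Σ_{t<p}K(t+1))·X`. [folklore] -/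
private theorem abs_sum_range_succ_sub_le' {p : ℕ} (F : ℕ → ℝ) (main X C₀ : ℝ) (K : ℕ → ℝ)
    (h0 : |F 0 - main| ≤ C₀ * X) (hK : ∀ t ∈ Finset.range p, |F (t + 1)| ≤ K (t + 1) * X) :
    |∑ t ∈ Finset.range (p + 1), F t - main| ≤ (C₀ + ∑ t ∈ Finset.range p, K (t + 1)) * X := by
  rw [Finset.sum_range_succ', show ∑ t ∈ Finset.range p, F (t + 1) + F 0 - main =
    (F 0 - main) + ∑ t ∈ Finset.range p, F (t + 1) by ring]
  calc _ ≤ |F 0 - main| + |∑ t ∈ Finset.range p, F (t + 1)| := abs_add_le _ _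
    _ ≤ C₀ * X + ∑ t ∈ Finset.range p, K (t + 1) * X :=
        add_le_add h0 ((Finset.abs_sum_le_sum_abs _ _).trans (Finset.sum_le_sum hK))
    _ = (C₀ + ∑ t ∈ Finset.range p, K (t + 1)) * X := by rw [← Finset.sum_mul]; ring

/-! ### Exact expansion -/

/-- **Exact expansion of a decorated shifted block** along `B = (λlog M − log(M/(cg))) − log g`.
[cite: KowalskiMichelVanderKam2000, (23) — derivation] -/
theorem selbergBlockDecor_expand (P : ℝ[X]) (M lam : ℝ) (p r₁ r₂ : ℕ) :
    ∑ c ∈ Icc 1 ⌊M⌋₊, ∑ g ∈ Icc 1 (⌊M⌋₊ / c), (μ g : ℝ) * c *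
        ∑ k₁ ∈ Icc 1 (⌊M⌋₊ / (c * g)), ∑ k₂ ∈ Icc 1 (⌊M⌋₊ / (c * g)),
          ((μ (c * g * k₁) : ℝ) * ((psi (c * g * k₁))⁻¹ *
              P.eval (Real.log (M / ((c * g * k₁ : ℕ) : ℝ)) / Real.log M))) / ((c * g * k₁ : ℕ) : ℝ) *
            (((μ (c * g * k₂) : ℝ) * ((psi (c * g * k₂))⁻¹ *
              P.eval (Real.log (M / ((c * g * k₂ : ℕ) : ℝ)) / Real.log M))) / ((c * g * k₂ : ℕ) : ℝ)) *
            (((k₁.divisors.card : ℝ) * Dk k₁ * Real.log (M / ((c * g : ℕ) : ℝ) / k₁) ^ r₁) *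
              ((k₂.divisors.card : ℝ) * Real.log (M / ((c * g : ℕ) : ℝ) / k₂) ^ r₂) *
              (lam * Real.log M - Real.log g - Real.log (M / ((c * g : ℕ) : ℝ))) ^ p) =
      ∑ t ∈ Finset.range (p + 1), (p.choose t : ℝ) * (-1) ^ t *
        ∑ c ∈ Icc 1 ⌊M⌋₊, ∑ g ∈ Icc 1 (⌊M⌋₊ / c), (μ g : ℝ) * c * Real.log g ^ t * (W (c * g) ^ 2 *
          ((lam * Real.log M - Real.log (M / ((c * g : ℕ) : ℝ))) ^ (p - t) *
            (∑ c' ∈ Finset.range (P.natDegree + 1), P.coeff c' *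
              ((∑ k ∈ Icc 1 ⌊M / ((c * g : ℕ) : ℝ)⌋₊, (if k.Coprime (c * g) then W k else 0) *
                ((k.divisors.card : ℝ) * Dk k) * Real.log (M / ((c * g : ℕ) : ℝ) / k) ^ (c' + r₁)) / Real.log M ^ c')) *
            (∑ c' ∈ Finset.range (P.natDegree + 1), P.coeff c' *
              ((∑ k ∈ Icc 1 ⌊M / ((c * g : ℕ) : ℝ)⌋₊, (if k.Coprime (c * g) then W k else 0) * (k.divisors.card : ℝ) *
                Real.log (M / ((c * g : ℕ) : ℝ) / k) ^ (c' + r₂)) / Real.log M ^ c')))) := by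
  set S₁ : ℕ → ℝ := fun n ↦ ∑ c' ∈ Finset.range (P.natDegree + 1), P.coeff c' *
    ((∑ k ∈ Icc 1 ⌊M / n⌋₊, (if k.Coprime n then W k else 0) * ((k.divisors.card : ℝ) * Dk k) *
      Real.log (M / n / k) ^ (c' + r₁)) / Real.log M ^ c') with hS₁
  set S₂ : ℕ → ℝ := fun n ↦ ∑ c' ∈ Finset.range (P.natDegree + 1), P.coeff c' *
    ((∑ k ∈ Icc 1 ⌊M / n⌋₊, (if k.Coprime n then W k else 0) * (k.divisors.card : ℝ) *
      Real.log (M / n / k) ^ (c' + r₂)) / Real.log M ^ c') with hS₂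
  have hinner : ∀ c ∈ Icc 1 ⌊M⌋₊, ∀ g ∈ Icc 1 (⌊M⌋₊ / c),
      ∑ k₁ ∈ Icc 1 (⌊M⌋₊ / (c * g)), ∑ k₂ ∈ Icc 1 (⌊M⌋₊ / (c * g)),
          ((μ (c * g * k₁) : ℝ) * ((psi (c * g * k₁))⁻¹ *
              P.eval (Real.log (M / ((c * g * k₁ : ℕ) : ℝ)) / Real.log M))) / ((c * g * k₁ : ℕ) : ℝ) *
            (((μ (c * g * k₂) : ℝ) * ((psi (c * g * k₂))⁻¹ *
              P.eval (Real.log (M / ((c * g * k₂ : ℕ) : ℝ)) / Real.log M))) / ((c * g * k₂ : ℕ) : ℝ)) *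
            (((k₁.divisors.card : ℝ) * Dk k₁ * Real.log (M / ((c * g : ℕ) : ℝ) / k₁) ^ r₁) *
              ((k₂.divisors.card : ℝ) * Real.log (M / ((c * g : ℕ) : ℝ) / k₂) ^ r₂) *
              (lam * Real.log M - Real.log g - Real.log (M / ((c * g : ℕ) : ℝ))) ^ p) =
        (lam * Real.log M - Real.log g - Real.log (M / ((c * g : ℕ) : ℝ))) ^ p *
          (W (c * g) ^ 2 * (S₁ (c * g) * S₂ (c * g))) := by
    intro c hc g hg
    have hc0 : c ≠ 0 := by have := (Finset.mem_Icc.1 hc).1; omega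
    have hg0 : g ≠ 0 := by have := (Finset.mem_Icc.1 hg).1; omega
    set Bp := (lam * Real.log M - Real.log g - Real.log (M / ((c * g : ℕ) : ℝ))) ^ p with hBp
    set t₁ : ℕ → ℝ := fun k ↦ (k.divisors.card : ℝ) * Dk k * Real.log (M / ((c * g : ℕ) : ℝ) / k) ^ r₁ with ht₁
    set t₂ : ℕ → ℝ := fun k ↦ (k.divisors.card : ℝ) * Real.log (M / ((c * g : ℕ) : ℝ) / k) ^ r₂ * Bp with ht₂
    have h := selbergInner_eq_W_sq_mul P M (mul_ne_zero hc0 hg0) t₁ t₂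
    have hre : ∑ k₁ ∈ Icc 1 (⌊M⌋₊ / (c * g)), ∑ k₂ ∈ Icc 1 (⌊M⌋₊ / (c * g)),
        ((μ (c * g * k₁) : ℝ) * ((psi (c * g * k₁))⁻¹ *
            P.eval (Real.log (M / ((c * g * k₁ : ℕ) : ℝ)) / Real.log M))) / ((c * g * k₁ : ℕ) : ℝ) *
          (((μ (c * g * k₂) : ℝ) * ((psi (c * g * k₂))⁻¹ *
            P.eval (Real.log (M / ((c * g * k₂ : ℕ) : ℝ)) / Real.log M))) / ((c * g * k₂ : ℕ) : ℝ)) *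
          (((k₁.divisors.card : ℝ) * Dk k₁ * Real.log (M / ((c * g : ℕ) : ℝ) / k₁) ^ r₁) *
            ((k₂.divisors.card : ℝ) * Real.log (M / ((c * g : ℕ) : ℝ) / k₂) ^ r₂) * Bp) =
        ∑ k₁ ∈ Icc 1 (⌊M⌋₊ / (c * g)), ∑ k₂ ∈ Icc 1 (⌊M⌋₊ / (c * g)),
        ((μ (c * g * k₁) : ℝ) * ((psi (c * g * k₁))⁻¹ *
            P.eval (Real.log (M / ((c * g * k₁ : ℕ) : ℝ)) / Real.log M))) / ((c * g * k₁ : ℕ) : ℝ) *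
          (((μ (c * g * k₂) : ℝ) * ((psi (c * g * k₂))⁻¹ *
            P.eval (Real.log (M / ((c * g * k₂ : ℕ) : ℝ)) / Real.log M))) / ((c * g * k₂ : ℕ) : ℝ)) *
          (t₁ k₁ * t₂ k₂) :=
      Finset.sum_congr rfl fun k₁ _ ↦ Finset.sum_congr rfl fun k₂ _ ↦ by simp only [ht₁, ht₂]; ring
    rw [hre, h]
    have h1 : ∑ c' ∈ Finset.range (P.natDegree + 1), P.coeff c' *
        ((∑ k ∈ Icc 1 ⌊M / ((c * g : ℕ) : ℝ)⌋₊, (if k.Coprime (c * g) then W k else 0) * t₁ k *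
          Real.log (M / ((c * g : ℕ) : ℝ) / k) ^ c') / Real.log M ^ c') = S₁ (c * g) := by
      simp only [hS₁, ht₁]
      refine Finset.sum_congr rfl fun c' _ ↦ ?_
      congr 1; congr 1
      refine Finset.sum_congr rfl fun k _ ↦ ?_
      rw [pow_add]; ring
    have h2 : ∑ c' ∈ Finset.range (P.natDegree + 1), P.coeff c' *
        ((∑ k ∈ Icc 1 ⌊M / ((c * g : ℕ) : ℝ)⌋₊, (if k.Coprime (c * g) then W k else 0) * t₂ k *
          Real.log (M / ((c * g : ℕ) : ℝ) / k) ^ c') / Real.log M ^ c') = Bp * S₂ (c * g) := by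
      simp only [hS₂, ht₂]
      rw [Finset.mul_sum]
      refine Finset.sum_congr rfl fun c' _ ↦ ?_
      have hk : ∑ k ∈ Icc 1 ⌊M / ((c * g : ℕ) : ℝ)⌋₊, (if k.Coprime (c * g) then W k else 0) *
          ((k.divisors.card : ℝ) * Real.log (M / ((c * g : ℕ) : ℝ) / k) ^ r₂ * Bp) *
            Real.log (M / ((c * g : ℕ) : ℝ) / k) ^ c' =
          Bp * ∑ k ∈ Icc 1 ⌊M / ((c * g : ℕ) : ℝ)⌋₊, (if k.Coprime (c * g) then W k else 0) *
            (k.divisors.card : ℝ) * Real.log (M / ((c * g : ℕ) : ℝ) / k) ^ (c' + r₂) := by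
        rw [Finset.mul_sum]
        exact Finset.sum_congr rfl fun k _ ↦ by rw [pow_add]; ring
      rw [hk]; ring
    rw [h1, h2]; ring
  rw [Finset.sum_congr rfl fun c hc ↦ Finset.sum_congr rfl fun g hg ↦ congrArg _ (hinner c hc g hg)]
  have hstep : ∀ c g : ℕ, (μ g : ℝ) * c * ((lam * Real.log M - Real.log g - Real.log (M / ((c * g : ℕ) : ℝ))) ^ p *
      (W (c * g) ^ 2 * (S₁ (c * g) * S₂ (c * g)))) =
      ∑ t ∈ Finset.range (p + 1), (p.choose t : ℝ) * (-1) ^ t *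
        ((μ g : ℝ) * c * Real.log g ^ t * (W (c * g) ^ 2 *
          ((lam * Real.log M - Real.log (M / ((c * g : ℕ) : ℝ))) ^ (p - t) * S₁ (c * g) * S₂ (c * g)))) := by
    intro c g
    rw [show lam * Real.log M - Real.log g - Real.log (M / ((c * g : ℕ) : ℝ)) =
      (lam * Real.log M - Real.log (M / ((c * g : ℕ) : ℝ))) - Real.log g by ring]
    exact moebius_mul_sub_log_pow_eq' g c _ (W (c * g) ^ 2) (S₁ (c * g)) (S₂ (c * g)) p
  rw [Finset.sum_congr rfl fun c _ ↦ Finset.sum_congr rfl fun g _ ↦ hstep c g]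
  rw [Finset.sum_congr rfl fun c _ ↦ Finset.sum_comm, Finset.sum_comm]
  refine Finset.sum_congr rfl fun t _ ↦ ?_
  rw [Finset.mul_sum (Icc 1 ⌊M⌋₊)]
  refine Finset.sum_congr rfl fun c _ ↦ ?_
  rw [Finset.mul_sum (Icc 1 (⌊M⌋₊ / c))]

/-! ### The decorated block asymptotic -/

/-- **THE DECORATED SHIFTED BLOCK ASYMPTOTIC** from a master family `(R_{r₁}, s)` of the decoration `D` on `k₁`
(`0 ≤ λ ≤ 1`, `P₀ = P₁ = 0`; see the module docstring).
[cite: KowalskiMichelVanderKam2000, (23)–(28) and Prop. 5.1 — derivation (diagonal main term in real Selberg coordinates)] -/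
theorem abs_selbergBlockDecor_sub_le (P : ℝ[X]) (hP0 : P.coeff 0 = 0) (hP1 : P.coeff 1 = 0) (p r₁ r₂ : ℕ)
    {lam : ℝ} (hlam0 : 0 ≤ lam) (hlam1 : lam ≤ 1) {C₁ : ℝ} (hC₁ : 0 ≤ C₁)
    (hT : ∀ M : ℝ, 3 ≤ M → ∀ n : ℕ, n ≠ 0 → (n : ℝ) ≤ M →
      |(∑ c ∈ Finset.range (P.natDegree + 1), P.coeff c *
          ((∑ k ∈ Icc 1 ⌊M / n⌋₊, (if k.Coprime n then W k else 0) * ((k.divisors.card : ℝ) * Dk k) *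
            Real.log (M / n / k) ^ (c + r₁)) / Real.log M ^ c)) / Real.log M ^ r₁ -
        mainConst n * (R r₁).eval (Real.log (M / n) / Real.log M) / Real.log M ^ s| ≤
        C₁ * divWeight n * ((1 + kappa n) / Real.log M ^ (s + 1) + 1 / ((1 + Real.log (M / n)) ^ 2 * Real.log M ^ s))) :
    ∃ C : ℝ, 0 < C ∧ ∀ M : ℝ, 3 ≤ M →
      |∑ c ∈ Icc 1 ⌊M⌋₊, ∑ g ∈ Icc 1 (⌊M⌋₊ / c), (μ g : ℝ) * c *
          ∑ k₁ ∈ Icc 1 (⌊M⌋₊ / (c * g)), ∑ k₂ ∈ Icc 1 (⌊M⌋₊ / (c * g)),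
            ((μ (c * g * k₁) : ℝ) * ((psi (c * g * k₁))⁻¹ *
                P.eval (Real.log (M / ((c * g * k₁ : ℕ) : ℝ)) / Real.log M))) / ((c * g * k₁ : ℕ) : ℝ) *
              (((μ (c * g * k₂) : ℝ) * ((psi (c * g * k₂))⁻¹ *
                P.eval (Real.log (M / ((c * g * k₂ : ℕ) : ℝ)) / Real.log M))) / ((c * g * k₂ : ℕ) : ℝ)) *
              (((k₁.divisors.card : ℝ) * Dk k₁ * Real.log (M / ((c * g : ℕ) : ℝ) / k₁) ^ r₁) *
                ((k₂.divisors.card : ℝ) * Real.log (M / ((c * g : ℕ) : ℝ) / k₂) ^ r₂) *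
                (lam * Real.log M - Real.log g - Real.log (M / ((c * g : ℕ) : ℝ))) ^ p) -
        (π ^ 2 / 6) ^ 2 * (∫ u in (0 : ℝ)..1,
            (((Polynomial.C lam - X) ^ p * R r₁) * derivative (derivative (X ^ r₂ * P))).eval u) *
          Real.log M ^ (p + r₁ + r₂) * Real.log M / Real.log M ^ (s + 2)| ≤
        C * Real.log M ^ (p + r₁ + r₂) / Real.log M ^ (s + 2) := by
  obtain ⟨C₀, hC₀, h0⟩ := abs_harmonicShiftedDecor_sub_le Dk R s P hP0 hP1 p r₁ r₂ hlam0 hlam1 hC₁ hT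
  -- crude size of the decorated coordinate
  obtain ⟨K₁, hK₁, hb₁⟩ := abs_profileCoord_crude_le (R r₁) s
    (fun M n ↦ (∑ c ∈ Finset.range (P.natDegree + 1), P.coeff c *
      ((∑ k ∈ Icc 1 ⌊M / n⌋₊, (if k.Coprime n then W k else 0) * ((k.divisors.card : ℝ) * Dk k) *
        Real.log (M / n / k) ^ (c + r₁)) / Real.log M ^ c)) / Real.log M ^ r₁) hC₁ hT
  have hb₁' : ∀ M : ℝ, 3 ≤ M → ∀ n : ℕ, n ≠ 0 → (n : ℝ) ≤ M →
      |∑ c ∈ Finset.range (P.natDegree + 1), P.coeff c *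
          ((∑ k ∈ Icc 1 ⌊M / n⌋₊, (if k.Coprime n then W k else 0) * ((k.divisors.card : ℝ) * Dk k) *
            Real.log (M / n / k) ^ (c + r₁)) / Real.log M ^ c)| ≤
        K₁ * divWeight n * Real.log M ^ r₁ / Real.log M ^ s := by
    intro M hM n hn hnM
    have hℓ1 : 1 ≤ Real.log M := one_le_log_of_three_le hM
    have hℓpos : 0 < Real.log M := by linarith
    have h' := hb₁ M hM n hn hnM
    rw [abs_div, abs_of_pos (pow_pos hℓpos r₁), div_le_iff₀ (pow_pos hℓpos r₁)] at h'
    calc _ ≤ K₁ * divWeight n / Real.log M ^ s * Real.log M ^ r₁ := h'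
      _ = K₁ * divWeight n * Real.log M ^ r₁ / Real.log M ^ s := by ring
  have hex : ∀ t : ℕ, ∃ C : ℝ, 0 < C ∧ (1 ≤ t → ∀ M : ℝ, 3 ≤ M →
      |∑ c ∈ Icc 1 ⌊M⌋₊, ∑ g ∈ Icc 1 (⌊M⌋₊ / c), (μ g : ℝ) * c * Real.log g ^ t * (W (c * g) ^ 2 *
          ((lam * Real.log M - Real.log (M / ((c * g : ℕ) : ℝ))) ^ (p - t) *
            (∑ c' ∈ Finset.range (P.natDegree + 1), P.coeff c' *
              ((∑ k ∈ Icc 1 ⌊M / ((c * g : ℕ) : ℝ)⌋₊, (if k.Coprime (c * g) then W k else 0) *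
                ((k.divisors.card : ℝ) * Dk k) * Real.log (M / ((c * g : ℕ) : ℝ) / k) ^ (c' + r₁)) / Real.log M ^ c')) *
            (∑ c' ∈ Finset.range (P.natDegree + 1), P.coeff c' *
              ((∑ k ∈ Icc 1 ⌊M / ((c * g : ℕ) : ℝ)⌋₊, (if k.Coprime (c * g) then W k else 0) * (k.divisors.card : ℝ) *
                Real.log (M / ((c * g : ℕ) : ℝ) / k) ^ (c' + r₂)) / Real.log M ^ c'))))| ≤
        C * Real.log M ^ (t + (p - t) + r₁ + r₂) / Real.log M ^ (s + 2)) := by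
    intro t
    by_cases ht : 1 ≤ t
    · obtain ⟨C, hC, h⟩ := abs_collapseShiftedDecor_logPow_le Dk s P hP0 hP1 ht (p - t) r₁ r₂ hlam0 hlam1 hK₁ hb₁'
      exact ⟨C, hC, fun _ ↦ h⟩
    · exact ⟨1, one_pos, fun h ↦ absurd h ht⟩
  choose Ct hCt0 hCt using hex
  have hKsum : 0 ≤ ∑ t ∈ Finset.range p, (p.choose (t + 1) : ℝ) * Ct (t + 1) :=
    Finset.sum_nonneg fun t _ ↦ by have := hCt0 (t + 1); positivity
  refine ⟨C₀ + ∑ t ∈ Finset.range p, (p.choose (t + 1) : ℝ) * Ct (t + 1), by positivity, fun M hM ↦ ?_⟩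
  have hℓ1 : 1 ≤ Real.log M := one_le_log_of_three_le hM
  have hℓpos : 0 < Real.log M := by linarith
  set Xe : ℝ := Real.log M ^ (p + r₁ + r₂) / Real.log M ^ (s + 2) with hXe
  rw [selbergBlockDecor_expand Dk P M lam p r₁ r₂]
  refine (abs_sum_range_succ_sub_le' _ _ Xe C₀ (fun t ↦ (p.choose t : ℝ) * Ct t) ?_ (fun t ht ↦ ?_)).trans_eq
    (by rw [hXe]; ring)
  · have h0' := h0 M hM
    simp only [Nat.choose_zero_right, Nat.cast_one, pow_zero, mul_one, one_mul, Nat.sub_zero]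
    rw [selbergCollapse_zero ⌊M⌋₊ (fun n ↦ W n ^ 2 * ((lam * Real.log M - Real.log (M / n)) ^ p *
      (∑ c ∈ Finset.range (P.natDegree + 1), P.coeff c *
        ((∑ k ∈ Icc 1 ⌊M / n⌋₊, (if k.Coprime n then W k else 0) * ((k.divisors.card : ℝ) * Dk k) *
          Real.log (M / n / k) ^ (c + r₁)) / Real.log M ^ c)) *
      (∑ c ∈ Finset.range (P.natDegree + 1), P.coeff c *
        ((∑ k ∈ Icc 1 ⌊M / n⌋₊, (if k.Coprime n then W k else 0) * (k.divisors.card : ℝ) *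
          Real.log (M / n / k) ^ (c + r₂)) / Real.log M ^ c))))]
    have hre : ∑ n ∈ Icc 1 ⌊M⌋₊, (Nat.totient n : ℝ) * (W n ^ 2 * ((lam * Real.log M - Real.log (M / n)) ^ p *
        (∑ c ∈ Finset.range (P.natDegree + 1), P.coeff c *
          ((∑ k ∈ Icc 1 ⌊M / n⌋₊, (if k.Coprime n then W k else 0) * ((k.divisors.card : ℝ) * Dk k) *
            Real.log (M / n / k) ^ (c + r₁)) / Real.log M ^ c)) *
        (∑ c ∈ Finset.range (P.natDegree + 1), P.coeff c *
          ((∑ k ∈ Icc 1 ⌊M / n⌋₊, (if k.Coprime n then W k else 0) * (k.divisors.card : ℝ) *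
            Real.log (M / n / k) ^ (c + r₂)) / Real.log M ^ c)))) =
        ∑ n ∈ Icc 1 ⌊M⌋₊, (Nat.totient n : ℝ) * W n ^ 2 * ((lam * Real.log M - Real.log (M / n)) ^ p *
        (∑ c ∈ Finset.range (P.natDegree + 1), P.coeff c *
          ((∑ k ∈ Icc 1 ⌊M / n⌋₊, (if k.Coprime n then W k else 0) * ((k.divisors.card : ℝ) * Dk k) *
            Real.log (M / n / k) ^ (c + r₁)) / Real.log M ^ c)) *
        (∑ c ∈ Finset.range (P.natDegree + 1), P.coeff c *
          ((∑ k ∈ Icc 1 ⌊M / n⌋₊, (if k.Coprime n then W k else 0) * (k.divisors.card : ℝ) *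
            Real.log (M / n / k) ^ (c + r₂)) / Real.log M ^ c))) :=
      Finset.sum_congr rfl fun n _ ↦ by ring
    rw [hre, hXe, ← mul_div_assoc]
    exact h0'
  · have htp : t < p := Finset.mem_range.1 ht
    have h := hCt (t + 1) (by omega) M hM
    have e : t + 1 + (p - (t + 1)) + r₁ + r₂ = p + r₁ + r₂ := by omega
    rw [e] at h
    have h' : |∑ c ∈ Icc 1 ⌊M⌋₊, ∑ g ∈ Icc 1 (⌊M⌋₊ / c), (μ g : ℝ) * c * Real.log g ^ (t + 1) * (W (c * g) ^ 2 *
          ((lam * Real.log M - Real.log (M / ((c * g : ℕ) : ℝ))) ^ (p - (t + 1)) *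
            (∑ c' ∈ Finset.range (P.natDegree + 1), P.coeff c' *
              ((∑ k ∈ Icc 1 ⌊M / ((c * g : ℕ) : ℝ)⌋₊, (if k.Coprime (c * g) then W k else 0) *
                ((k.divisors.card : ℝ) * Dk k) * Real.log (M / ((c * g : ℕ) : ℝ) / k) ^ (c' + r₁)) / Real.log M ^ c')) *
            (∑ c' ∈ Finset.range (P.natDegree + 1), P.coeff c' *
              ((∑ k ∈ Icc 1 ⌊M / ((c * g : ℕ) : ℝ)⌋₊, (if k.Coprime (c * g) then W k else 0) * (k.divisors.card : ℝ) *
                Real.log (M / ((c * g : ℕ) : ℝ) / k) ^ (c' + r₂)) / Real.log M ^ c'))))| ≤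
        Ct (t + 1) * Xe := by
      rw [hXe, ← mul_div_assoc]; exact h
    rw [abs_mul, abs_mul, abs_pow, abs_neg, abs_one, one_pow, mul_one,
      abs_of_nonneg (by positivity : (0 : ℝ) ≤ (p.choose (t + 1) : ℝ)), mul_assoc]
    exact mul_le_mul_of_nonneg_left h' (by positivity)

/-! ### The instance `D = P₂` -/

/-- **The `P₂`-decorated shifted coordinate in two-scale master format**: `R_r = −2·X^rP`, `s = 0`
(`P₀ = P₁ = 0`, `M ≥ 3`, `1 ≤ n ≤ M`). [cite: KowalskiMichelVanderKam2000, (23)–(28) — derivation] -/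
theorem abs_shiftedCoordPrimeSq_sub_le (P : ℝ[X]) (hP0 : P.coeff 0 = 0) (hP1 : P.coeff 1 = 0) (r : ℕ) :
    ∃ C : ℝ, 0 ≤ C ∧ ∀ M : ℝ, 3 ≤ M → ∀ n : ℕ, n ≠ 0 → (n : ℝ) ≤ M →
      |(∑ c ∈ Finset.range (P.natDegree + 1), P.coeff c *
          ((∑ k ∈ Icc 1 ⌊M / n⌋₊, (if k.Coprime n then W k else 0) *
              ((k.divisors.card : ℝ) * ∑ p ∈ k.primeFactors, Real.log p ^ 2) *
            Real.log (M / n / k) ^ (c + r)) / Real.log M ^ c)) / Real.log M ^ r -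
        mainConst n * ((fun r' : ℕ ↦ -(2 : ℝ) • (X ^ r' * P)) r).eval (Real.log (M / n) / Real.log M) /
          Real.log M ^ 0| ≤
        C * divWeight n * ((1 + kappa n) / Real.log M ^ (0 + 1) +
          1 / ((1 + Real.log (M / n)) ^ 2 * Real.log M ^ 0)) := by
  obtain ⟨C, hC, h⟩ := masterInput_tau_primeSq (X ^ r * P) (coeff_X_pow_mul_zero P hP0 r)
    (coeff_X_pow_mul_one P hP0 hP1 r)
  refine ⟨C, hC, fun M hM n hn hnM ↦ ?_⟩
  have hℓ1 : 1 ≤ Real.log M := one_le_log_of_three_le hM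
  have hℓ0 : Real.log M ≠ 0 := by linarith
  have hshift : ∑ c ∈ Finset.range (P.natDegree + 1), P.coeff c *
      ((∑ k ∈ Icc 1 ⌊M / n⌋₊, (if k.Coprime n then W k else 0) *
          ((k.divisors.card : ℝ) * ∑ p ∈ k.primeFactors, Real.log p ^ 2) *
        Real.log (M / n / k) ^ (c + r)) / Real.log M ^ c) =
      Real.log M ^ r * ∑ c ∈ Finset.range ((X ^ r * P).natDegree + 1), (X ^ r * P).coeff c *
        ((∑ k ∈ Icc 1 ⌊M / n⌋₊, (if k.Coprime n then W k else 0) *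
          ((k.divisors.card : ℝ) * ∑ p ∈ k.primeFactors, Real.log p ^ 2) *
          Real.log (M / n / k) ^ c) / Real.log M ^ c) := by
    rw [sum_coeff_X_pow_mul, Finset.mul_sum]
    refine Finset.sum_congr rfl fun c _ ↦ ?_
    rw [pow_add]
    field_simp
  rw [hshift, mul_div_cancel_left₀ _ (pow_ne_zero r hℓ0)]
  exact h M hM n hn hnM

end Summit.Parity.GeneralizedHardyLittlewood.Theorems.MomentsBeyondDiagonal.DiagKernel

end
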